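import Mathlib
import HarnessLib
import Summits.KontsevichZagierPeriods.KontsevichZagierPeriods.Theses.LinRedNormalForm
import Summits.KontsevichZagierPeriods.KontsevichZagierPeriods.Theorems.LinRedNormalFormDihedralNormalFormStubNestedReductionAux5
import Summits.KontsevichZagierPeriods.KontsevichZagierPeriods.Theorems.LinRedNormalFormDihedralNormalFormStubNestedReductionAux9
import Summits.KontsevichZagierPeriods.KontsevichZagierPeriods.Theorems.LinRedNormalFormDihedralNormalFormStubAtomReductionAux3

/-!
# `DihedralNormalForm`, line `torus-descent-sum-shadow`, stub `stub_nestedReduction` — Aux 11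

Support file for the stub `stub_nestedReduction` (THEOREM N) of the crux `DihedralNormalForm`
(stmt-KontsevichZagierPeriods-3912, route `LinRedNormalForm`): **the elementary moves and the
terminal shapes** of the induction.
* the shift / peel identity
  `[a, e] = [a + 𝟙_{[i,j]}, e] + [a, e + δ_{[i,j]}]` (`x_{[i,j]} + (1 − x_{[i,j]}) = 1`) as ONE
  integrand-additivity move (`Nested.shift_mem_relations`);
* the two SD1-directed exits of a simple prefix chain `xᵃ/∏_{p ∈ P}(1 − x_{[0,p]})`: the last
  coordinate uncovered (`lam = −𝟙_{last}`), or a jump of `a` inside an annulus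
  (`lam = 𝟙_l − 𝟙_{l+1}`);
* the word atom: for `a l = #{p ∈ P | p ≥ l} − 1` the chain IS the word atom of
  `ε = 𝟙_P` (`Nested.word_eqOn`).

References: M. Kontsevich, D. Zagier, *Periods* (2001), §1.2; F. Brown, *Mixed Tate motives
over ℤ*, Ann. of Math. 175 (2012).
-/

noncomputable section

open MeasureTheory Set

namespace Summit.KontsevichZagierPeriods.DihedralNormalForm.TorusDescent

open Literature.NumberTheory.Transcendental

namespace Nested

variable {k m : ℕ}

/-! ## Atom representations and the shift move -/

/-- The atom integrand only reads the exponents of genuine chords `i ≤ j`. -/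
theorem atomQ_congr {q : ℚ} {a : Fin k → ℕ} {e e' : Fin k → Fin k → ℤ}
    (h : ∀ i j : Fin k, i ≤ j → e i j = e' i j) : atomQ k q a e = atomQ k q a e' := by
  funext x
  simp only [atomQ]
  congr 2
  refine Finset.prod_congr rfl fun i _ => Finset.prod_congr rfl fun j _ => ?_
  split_ifs with hij
  · rw [h i j hij]
  · rfl

/-- Scaling the coefficient. -/
theorem atomQ_mul (c q : ℚ) (a : Fin k → ℕ) (e : Fin k → Fin k → ℤ) (x : Fin k → ℝ) :
    atomQ k (c * q) a e x = (c : ℝ) * atomQ k q a e x := by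
  simp only [atomQ, Rat.cast_mul, mul_assoc]

/-- `a + 𝟙_{[i₀,j₀]}`. -/
def aup (a : Fin k → ℕ) (i₀ j₀ : Fin k) : Fin k → ℕ :=
  fun l => a l + if i₀ ≤ l ∧ l ≤ j₀ then 1 else 0

/-- Multiplying the monomial by the chord `x_{[i₀,j₀]}` raises `a` by `𝟙_{[i₀,j₀]}`. -/
theorem prod_pow_aup (a : Fin k → ℕ) (i₀ j₀ : Fin k) (x : Fin k → ℝ) :
    (∏ l : Fin k, x l ^ aup a i₀ j₀ l) =
      (∏ l : Fin k, x l ^ a l) * ∏ l : Fin k, if i₀ ≤ l ∧ l ≤ j₀ then x l else 1 := by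
  rw [← Finset.prod_mul_distrib]
  refine Finset.prod_congr rfl fun l _ => ?_
  unfold aup
  split_ifs <;> simp [pow_succ]

/-- Raising the exponent of the chord `[i₀,j₀]` multiplies the chord part by `1 − x_{[i₀,j₀]}`. -/
theorem chords_eadd_one (e : Fin k → Fin k → ℤ) {i₀ j₀ : Fin k} (hij : i₀ ≤ j₀) {x : Fin k → ℝ}
    (hx : x ∈ ocube k) :
    (∏ i : Fin k, ∏ j : Fin k, if i ≤ j then
        (1 - (∏ l : Fin k, if i ≤ l ∧ l ≤ j then x l else 1)) ^ eadd e i₀ j₀ 1 i j else (1:ℝ)) =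
      (∏ i : Fin k, ∏ j : Fin k, if i ≤ j then
        (1 - (∏ l : Fin k, if i ≤ l ∧ l ≤ j then x l else 1)) ^ e i j else (1:ℝ)) *
        (1 - ∏ l : Fin k, if i₀ ≤ l ∧ l ≤ j₀ then x l else 1) := by
  have key : ∀ i j : Fin k, (if i ≤ j then
      (1 - (∏ l : Fin k, if i ≤ l ∧ l ≤ j then x l else 1)) ^ eadd e i₀ j₀ 1 i j else (1:ℝ)) =
      (if i ≤ j then (1 - (∏ l : Fin k, if i ≤ l ∧ l ≤ j then x l else 1)) ^ e i j else (1:ℝ)) *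
        (if i = i₀ ∧ j = j₀ then (1 - ∏ l : Fin k, if i₀ ≤ l ∧ l ≤ j₀ then x l else 1) else 1) := by
    intro i j
    rw [eadd_apply]
    by_cases h : i = i₀ ∧ j = j₀
    · obtain ⟨rfl, rfl⟩ := h
      rw [if_pos hij, if_pos hij, if_pos ⟨rfl, rfl⟩, if_pos ⟨rfl, rfl⟩,
        zpow_add_one₀ (AtomReduction.one_sub_cp_pos hij hx).ne']
    · rw [if_neg h, if_neg h, add_zero, mul_one]
  simp_rw [key, Finset.prod_mul_distrib]
  congr 1
  rw [Finset.prod_eq_single i₀ (fun i _ hi => Finset.prod_eq_one fun j _ => if_neg fun h => hi h.1)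
    (fun h => absurd (Finset.mem_univ _) h), Finset.prod_eq_single j₀
    (fun j _ hj => if_neg fun h => hj h.2) (fun h => absurd (Finset.mem_univ _) h), if_pos ⟨rfl, rfl⟩]

/-- **The shift identity** `[a,e] = [a + 𝟙_{[i₀,j₀]}, e] + [a, e + δ_{(i₀,j₀)}]` pointwise on the
open cube (`x_I + (1 − x_I) = 1`). -/
theorem atomQ_shift (q : ℚ) (a : Fin k → ℕ) (e : Fin k → Fin k → ℤ) {i₀ j₀ : Fin k} (hij : i₀ ≤ j₀)
    {x : Fin k → ℝ} (hx : x ∈ ocube k) :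
    atomQ k q a e x = atomQ k q (aup a i₀ j₀) e x + atomQ k q a (eadd e i₀ j₀ 1) x := by
  simp only [atomQ]
  rw [prod_pow_aup, chords_eadd_one e hij hx]
  ring

/-- **The shift move**: three representations of `[a,e]`, `[a + 𝟙_I, e]`, `[a, e + δ_I]` on the open
cube differ by ONE integrand-additivity relation. -/
theorem shift_mem_relations (q : ℚ) (a : Fin k → ℕ) (e : Fin k → Fin k → ℤ) {i₀ j₀ : Fin k}
    (hij : i₀ ≤ j₀) (s s₁ s₂ : KZ.IntegralRep k) (hs : s.domain = ocube k) (hs₁ : s₁.domain = ocube k)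
    (hs₂ : s₂.domain = ocube k) (hi : EqOn s.integrand (atomQ k q a e) s.domain)
    (hi₁ : EqOn s₁.integrand (atomQ k q (aup a i₀ j₀) e) s₁.domain)
    (hi₂ : EqOn s₂.integrand (atomQ k q a (eadd e i₀ j₀ 1)) s₂.domain) :
    KZ.of s - KZ.of s₁ - KZ.of s₂ ∈ KZ.relations := by
  refine KZ.integrandAddRel_subset_relations ⟨k, s, s₁, s₂, by rw [hs, hs₁], by rw [hs, hs₂],
    fun x hx => ?_, rfl⟩
  rw [Pi.add_apply, hi hx, hi₁ (by rw [hs₁, ← hs]; exact hx), hi₂ (by rw [hs₂, ← hs]; exact hx)]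
  exact atomQ_shift q a e hij (hs ▸ hx)

/-! ## SD1-directed exits of a simple prefix chain -/

/-- The active chords of `eP P` are the `[0,p]`, `p ∈ P`: a direction summing to zero on them. -/
theorem chord_sum_eP {P : Finset (Fin (m + 1))} {lam : Fin (m + 1) → ℤ}
    (h : ∀ p ∈ P, (∑ l : Fin (m + 1), if l ≤ p then lam l else 0) = 0) (i j : Fin (m + 1))
    (_hij : i ≤ j) (hne : eP P i j ≠ 0) :
    (∑ l : Fin (m + 1), if i ≤ l ∧ l ≤ j then lam l else 0) = 0 := by
  rw [eP_apply] at hne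
  by_cases hc : (i : ℕ) = 0 ∧ j ∈ P
  · have hi : i = 0 := Fin.ext hc.1
    subst hi
    refine (Finset.sum_congr rfl fun l _ => ?_).trans (h j hc.2)
    simp
  · exact absurd (if_neg hc) hne

/-- **Exit 1: the last coordinate is uncovered.**  If `last ∉ P`, the chain `[q, a, eP P]` is
SD1-directed by `lam = −𝟙_{last}`. -/
theorem of_mem_target_of_last_not_mem {P : Finset (Fin (m + 1))} (hlast : Fin.last m ∉ P) (q : ℚ)
    (a : Fin (m + 1) → ℕ) (s : KZ.IntegralRep (m + 1)) (hs : s.domain = ocube (m + 1))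
    (hi : EqOn s.integrand (atomQ (m + 1) q a (eP P)) s.domain) : KZ.of s ∈ Target (m + 1) := by
  refine of_mem_target_of_sd1 q a (eP P) s (fun l => if l = Fin.last m then -1 else 0) (fun l => ?_)
    ⟨Fin.last m, if_pos rfl⟩ ?_ (chord_sum_eP fun p hp => ?_) ?_ hs hi
  · split_ifs <;> simp
  · refine le_trans (Finset.card_eq_zero.mpr (Finset.filter_eq_empty_iff.mpr fun l _ => ?_)).le
      zero_le_one
    split_ifs <;> simp
  · refine Finset.sum_eq_zero fun l _ => ?_
    by_cases hl : l = Fin.last m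
    · subst hl
      rw [if_neg]
      exact fun hle => hlast ((Fin.last_le_iff.mp hle) ▸ hp)
    · simp [hl]
  · rw [Finset.sum_eq_single (Fin.last m) (fun l _ hl => by simp [hl])
      (fun h => absurd (Finset.mem_univ _) h), if_pos rfl]
    have : (0 : ℤ) < (a (Fin.last m) : ℤ) + 1 := by positivity
    linarith

/-- **Exit 2: a jump of `a` inside an annulus.**  If `l₀ ∉ P` and `a l₀ ≠ a l₁` for the next
coordinate `l₁ = l₀ + 1`, the chain is SD1-directed by `lam = 𝟙_{l₀} − 𝟙_{l₁}`. -/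
theorem of_mem_target_of_jump {P : Finset (Fin (m + 1))} {l₀ l₁ : Fin (m + 1)} (hl₀ : l₀ ∉ P)
    (hl₁ : (l₁ : ℕ) = (l₀ : ℕ) + 1) (q : ℚ) (a : Fin (m + 1) → ℕ) (ha : a l₀ ≠ a l₁)
    (s : KZ.IntegralRep (m + 1)) (hs : s.domain = ocube (m + 1))
    (hi : EqOn s.integrand (atomQ (m + 1) q a (eP P)) s.domain) : KZ.of s ∈ Target (m + 1) := by
  have hne : l₀ ≠ l₁ := fun h => by
    have := congrArg Fin.val h; omega
  refine of_mem_target_of_sd1 q a (eP P) s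
    (fun l => if l = l₀ then 1 else if l = l₁ then -1 else 0) (fun l => ?_)
    ⟨l₁, by rw [if_neg hne.symm, if_pos rfl]⟩ ?_ (chord_sum_eP fun p hp => ?_) ?_ hs hi
  · split_ifs <;> simp
  · refine (Finset.card_le_one.mpr fun x hx y hy => ?_)
    simp only [Finset.mem_filter, Finset.mem_univ, true_and] at hx hy
    have hx' : x = l₀ := by
      by_contra h
      rw [if_neg h] at hx
      split_ifs at hx with h'; omega
    have hy' : y = l₀ := by
      by_contra h
      rw [if_neg h] at hy
      split_ifs at hy with h'; omega
    rw [hx', hy']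
  · -- the chord `[0,p]` contains both `l₀, l₀+1` or neither (`p ≠ l₀`)
    have hp0 : p ≠ l₀ := fun h => hl₀ (h ▸ hp)
    have hiff : l₀ ≤ p ↔ l₁ ≤ p := by
      rw [Fin.le_def, Fin.le_def, hl₁]
      constructor
      · intro h
        rcases Nat.lt_or_ge (l₀ : ℕ) p with h' | h'
        · exact h'
        · exact absurd (Fin.ext (le_antisymm h' h)) hp0
      · omega
    rw [← Finset.sum_filter]
    have hsplit : ∀ l : Fin (m + 1), (if l = l₀ then (1:ℤ) else if l = l₁ then -1 else 0) =
        (if l = l₀ then 1 else 0) + (if l = l₁ then -1 else 0) := by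
      intro l
      by_cases h1 : l = l₀
      · subst h1; simp [hne]
      · simp [h1]
    simp_rw [hsplit, Finset.sum_add_distrib, Finset.sum_ite_eq', Finset.mem_filter, Finset.mem_univ,
      true_and]
    by_cases h : l₀ ≤ p
    · rw [if_pos h, if_pos (hiff.mp h)]; norm_num
    · rw [if_neg h, if_neg (fun h' => h (hiff.mpr h'))]; norm_num
  · have hsplit : ∀ l : Fin (m + 1), (if l = l₀ then (1:ℤ) else if l = l₁ then -1 else 0) * ((a l : ℤ) + 1) =
        (if l = l₀ then ((a l : ℤ) + 1) else 0) + (if l = l₁ then -((a l : ℤ) + 1) else 0) := by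
      intro l
      by_cases h1 : l = l₀
      · subst h1; simp [hne]
      · by_cases h2 : l = l₁
        · subst h2; simp [h1]
        · simp [h1, h2]
    simp_rw [hsplit, Finset.sum_add_distrib, Finset.sum_ite_eq', Finset.mem_univ, if_true]
    have : (a l₀ : ℤ) ≠ (a l₁ : ℤ) := by exact_mod_cast ha
    omega

/-! ## The word atom -/

/-- The word exponents of the chain with endpoints `P`: `a l = #{p ∈ P | l ≤ p} − 1`. -/
def aword (P : Finset (Fin (m + 1))) : Fin (m + 1) → ℕ :=
  fun l => (P.filter fun p => l ≤ p).card - 1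

/-- Products of prefix chords as a monomial: `∏_{i ∈ S} x_{[0,i]} = ∏_l x_l^{#{i ∈ S | l ≤ i}}`. -/
theorem prod_prefix_eq_prod_pow (S : Finset (Fin (m + 1))) (x : Fin (m + 1) → ℝ) :
    (∏ i ∈ S, ∏ l : Fin (m + 1), if l ≤ i then x l else 1) =
      ∏ l : Fin (m + 1), x l ^ (S.filter fun i => l ≤ i).card := by
  rw [Finset.prod_comm]
  refine Finset.prod_congr rfl fun l _ => ?_
  rw [Finset.prod_ite, Finset.prod_const_one, mul_one, Finset.prod_const]

/-- Counting coordinates above `l`: `#{i ∈ P | l ≤ i} + #{i ∉ P | l ≤ i} = m + 1 − l`. -/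
theorem card_filter_add (P : Finset (Fin (m + 1))) (l : Fin (m + 1)) :
    (P.filter fun i => l ≤ i).card + ((Finset.univ \ P).filter fun i => l ≤ i).card = m + 1 - (l : ℕ) := by
  have h1 : (P.filter fun i => l ≤ i) = (Finset.univ.filter fun i : Fin (m + 1) => l ≤ i).filter (· ∈ P) := by
    ext i; simp [and_comm]
  have h2 : ((Finset.univ \ P).filter fun i => l ≤ i) =
      (Finset.univ.filter fun i : Fin (m + 1) => l ≤ i).filter (fun i => ¬ i ∈ P) := by
    ext i; simp [and_comm]
  rw [h1, h2, Finset.card_filter_add_card_filter_not]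
  have : (Finset.univ.filter fun i : Fin (m + 1) => l ≤ i) = Finset.Ici l := by ext i; simp
  rw [this, Fin.card_Ici]

/-- **The normalised chain is the word atom.**  For `last ∈ P`, on the open cube
`q · x^{aword P} / ∏_{p ∈ P} (1 − x_{[0,p]})` is the word integrand of `ε = 𝟙_P`. -/
theorem word_eqOn {P : Finset (Fin (m + 1))} (hlast : Fin.last m ∈ P) (q : ℚ) :
    EqOn (atomQ (m + 1) q (aword P) (eP P)) (fun x => (q : ℝ) *
      ((∏ i : Fin (m + 1), x i ^ (m + 1 - 1 - (i : ℕ))) *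
        ∏ i : Fin (m + 1), if (fun i => decide (i ∈ P)) i then
          1 / (1 - (∏ l : Fin (m + 1), if l ≤ i then x l else 1))
          else 1 / (∏ l : Fin (m + 1), if l ≤ i then x l else 1))) (ocube (m + 1)) := by
  intro x hx
  simp only [atomQ, decide_eq_true_eq, one_div]
  congr 1
  -- the chord part of the chain
  have hch : (∏ i : Fin (m + 1), ∏ j : Fin (m + 1), if i ≤ j then
      (1 - (∏ l : Fin (m + 1), if i ≤ l ∧ l ≤ j then x l else 1)) ^ eP P i j else (1:ℝ)) =
      ∏ j ∈ P, (1 - ∏ l : Fin (m + 1), if l ≤ j then x l else 1)⁻¹ := by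
    rw [Finset.prod_eq_single (0 : Fin (m + 1))]
    · rw [← Finset.prod_filter_mul_prod_filter_not Finset.univ (· ∈ P)]
      have hP : Finset.univ.filter (· ∈ P) = P := by ext; simp
      rw [hP]
      have h1 : ∏ j ∈ Finset.univ.filter (fun j => ¬ j ∈ P), (if (0 : Fin (m + 1)) ≤ j then
          (1 - (∏ l : Fin (m + 1), if 0 ≤ l ∧ l ≤ j then x l else 1)) ^ eP P 0 j else (1:ℝ)) = 1 :=
        Finset.prod_eq_one fun j hj => by
          rw [Finset.mem_filter] at hj
          simp [eP_apply, hj.2]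
      rw [h1, mul_one]
      refine Finset.prod_congr rfl fun j hj => ?_
      simp [eP_apply, hj]
    · intro i _ hi
      refine Finset.prod_eq_one fun j _ => ?_
      have hi' : (i : ℕ) ≠ 0 := fun h => hi (Fin.ext h)
      simp [eP_apply, hi']
    · intro h; exact absurd (Finset.mem_univ _) h
  have hP : Finset.univ.filter (· ∈ P) = P := by ext; simp
  have hP' : Finset.univ.filter (fun i => ¬ i ∈ P) = Finset.univ \ P := by ext; simp
  rw [hch, Finset.prod_ite, hP, hP', Finset.prod_inv_distrib (s := Finset.univ \ P)]
  -- the monomials: `x^{aword P} = (∏ x_i^{m-i}) · (∏_{i ∉ P} x_{[0,i]})⁻¹`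
  have hpos : (∏ i ∈ Finset.univ \ P, ∏ l : Fin (m + 1), if l ≤ i then x l else 1) ≠ 0 := by
    refine Finset.prod_ne_zero_iff.mpr fun i _ => Finset.prod_ne_zero_iff.mpr fun l _ => ?_
    split_ifs
    · exact (hx l).1.ne'
    · exact one_ne_zero
  suffices hsuff : (∏ i : Fin (m + 1), x i ^ aword P i) = (∏ i : Fin (m + 1), x i ^ (m + 1 - 1 - (i : ℕ))) *
      (∏ i ∈ Finset.univ \ P, ∏ l : Fin (m + 1), if l ≤ i then x l else 1)⁻¹ by
    rw [hsuff]; ring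
  rw [eq_mul_inv_iff_mul_eq₀ hpos, prod_prefix_eq_prod_pow, ← Finset.prod_mul_distrib]
  refine Finset.prod_congr rfl fun l _ => ?_
  rw [← pow_add]
  congr 1
  have h := card_filter_add P l
  have hl : 1 ≤ (P.filter fun i => l ≤ i).card :=
    Finset.card_pos.mpr ⟨Fin.last m, Finset.mem_filter.mpr ⟨hlast, Fin.le_last l⟩⟩
  unfold aword
  omega

end Nested

/-- **Registered sub-goal `stub_nestedReductionAux11`**: the shift identity `[a,e] = [a + 𝟙_I, e] + [a, e + δ_I]` of cubical atoms (`Nested.atomQ_shift`). -/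
theorem stub_nestedReductionAux11 : ∀ (k : ℕ) (q : ℚ) (a : Fin k → ℕ) (e : Fin k → Fin k → ℤ) (i₀ j₀ : Fin k), i₀ ≤ j₀ → ∀ x ∈ {x : Fin k → ℝ | ∀ i, x i ∈ Set.Ioo (0:ℝ) 1}, (q : ℝ) * ((∏ i : Fin k, x i ^ a i) * ∏ i : Fin k, ∏ j : Fin k, if i ≤ j then (1 - (∏ l : Fin k, if i ≤ l ∧ l ≤ j then x l else 1)) ^ e i j else 1) = (q : ℝ) * ((∏ i : Fin k, x i ^ (a i + if i₀ ≤ i ∧ i ≤ j₀ then 1 else 0)) * ∏ i : Fin k, ∏ j : Fin k, if i ≤ j then (1 - (∏ l : Fin k, if i ≤ l ∧ l ≤ j then x l else 1)) ^ e i j else 1) + (q : ℝ) * ((∏ i : Fin k, x i ^ a i) * ∏ i : Fin k, ∏ j : Fin k, if i ≤ j then (1 - (∏ l : Fin k, if i ≤ l ∧ l ≤ j then x l else 1)) ^ (e i j + if i = i₀ ∧ j = j₀ then 1 else 0) else 1) :=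
  fun _ q a e _ _ hij _ hx =>
    Nested.atomQ_shift q a e hij hx

end Summit.KontsevichZagierPeriods.DihedralNormalForm.TorusDescent
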